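import Mathlib
import HarnessLib

/-!
# QUANT lane R8, front "FAR beyond trees", layer one — THE DEGREE-THREE GATE AT THE OBSERVER, XII: the item lemmas (pure reals)

builds on p205010 (kernel theorem, internal audit signed; external expert review pending)

Support file (`--supports stmt-CriticalPhenomena-4575`), seat `prim-quant-p1` (gen 28); memo
`run/shared/lean/prim/quant/prim-quant-p1-g28/FOR-LEAD-GATE3.md` §5.  Mathlib only; standard axioms; no sorries; no definitions.

The type-level reduction of the general gate (memo §5): every certificate is an ITEM — a price `π ≥ 0` and a family — and closes the
layer-one row as soon as its type-level value is non-negative.  With `P = Σ_c φ_c x_c` (`= P(N ≥ 2)` lower bound), `Sub = Σ_c sub_c x_c`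
(the mean bound of file X), `S = Σ_b P(o ↔ b)`, `U ≥ P(N ≤ 1)`'s bound `U ≤ 1 − P`, the cuts `1 − q ≤ t` and `n − S ≤ n t`:
* `Gate3.item_A` (family A: `λ_S = nπ`, `μ = 0`): `(1 − nπ)·q ≤ P − π·Sub ⟹ U ≤ t`;
* `Gate3.item_B` (family B: `μ = π`): `q + π(Q + Sub − 2) ≤ P ⟹ U ≤ t` (uses the mean `2 ≤ Q + S`);
* `Gate3.item_C` (family C: `λ_S = 1`, `μ = π − 1/n`): `π(Q + Sub − 2) − (Q − 2)/n ≤ P`, `nπ ≥ 1 ⟹ U ≤ t`;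
* `Gate3.cells_lower`: `Σ_T t_T·M_T ≤ P − π·Sub` whenever `t_T ≤ φ_{T,k} − π·sub_{T,k}` on the fifteen cells (the `F(π;M)` of memo §5).
[this work].
-/

namespace Summit.CriticalPhenomena.PercolationContinuityZ3.Theorems

namespace Quant

namespace Gate3

/-- **Item, family A** (`λ_S = nπ ≤ 1`, no mean). [this work] -/
theorem item_A (P Sub S q t U nn π : ℝ) (hU : U ≤ 1 - P) (hS : S ≤ Sub) (hout : nn - S ≤ nn * t) (hq : 1 - q ≤ t)
    (hπ0 : 0 ≤ π) (hπ1 : nn * π ≤ 1) (cert : (1 - nn * π) * q ≤ P - π * Sub) : U ≤ t := by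
  have h1 : (1 - nn * π) * (1 - q) ≤ (1 - nn * π) * t := mul_le_mul_of_nonneg_left hq (by linarith)
  have h2 : π * (nn - S) ≤ π * (nn * t) := mul_le_mul_of_nonneg_left hout hπ0
  have h3 : π * S ≤ π * Sub := mul_le_mul_of_nonneg_left hS hπ0
  nlinarith

/-- **Item, family B** (`μ = π`, uses the mean hypothesis). [this work] -/
theorem item_B (P Sub S q Q t U π : ℝ) (hU : U ≤ 1 - P) (hS : S ≤ Sub) (hmean : 2 ≤ Q + S) (hq : 1 - q ≤ t) (hπ0 : 0 ≤ π)
    (cert : q + π * (Q + Sub - 2) ≤ P) : U ≤ t := by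
  have h1 : 0 ≤ π * (Q + Sub - 2) := mul_nonneg hπ0 (by linarith)
  linarith

/-- **Item, family C** (`λ_S = 1`, `μ = π − 1/n`, `nπ ≥ 1`). [this work] -/
theorem item_C (P Sub S Q t U nn π : ℝ) (hU : U ≤ 1 - P) (hS : S ≤ Sub) (hmean : 2 ≤ Q + S) (hout : nn - S ≤ nn * t)
    (hn : 0 < nn) (hπ1 : 1 ≤ nn * π) (cert : π * (Q + Sub - 2) - (Q - 2) / nn ≤ P) : U ≤ t := by
  have hπ0 : 0 ≤ π := by
    by_contra h
    have h' : 0 < -π := by linarith [not_le.1 h]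
    nlinarith [mul_pos hn h']
  have h1 : π * (Q + S - 2) ≤ π * (Q + Sub - 2) := mul_le_mul_of_nonneg_left (by linarith) hπ0
  have h2 : (1 / nn) * (Q + S - 2) ≤ π * (Q + S - 2) := by
    have : 1 / nn ≤ π := by rw [div_le_iff₀ hn]; linarith
    exact mul_le_mul_of_nonneg_right this (by linarith)
  have h3 : (1 / nn) * (Q + S - 2) - (Q - 2) / nn = S / nn := by field_simp; ring
  have hP : S / nn ≤ P := by linarith
  have ht : 1 - t ≤ S / nn := by
    rw [le_div_iff₀ hn]
    linarith
  linarith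

/-- **The fifteen cells**: with `t_T ≤ φ_{T,k} − π·sub_{T,k}` on every cell, `Σ_T t_T M_T ≤ P − π·Sub`
(`P = Σ φ_c x_c`, `Sub = Σ sub_c x_c`, cells `a0 a1 a2 | b₁0 b₁1 b₁2 | b₂0 b₂1 b₂2 | c0 c1 c2 | d0 d1 d2`, `nn = |B|`). [this work] -/
theorem cells_lower (p r₁ r₂ nn π t0 t1 t2 t3 t4 a0 a1 a2 b₁0 b₁1 b₁2 b₂0 b₂1 b₂2 c0 c1 c2 d0 d1 d2 : ℝ)
    (ha0n : 0 ≤ a0) (ha1n : 0 ≤ a1) (ha2n : 0 ≤ a2) (hb₁0n : 0 ≤ b₁0) (hb₁1n : 0 ≤ b₁1) (hb₁2n : 0 ≤ b₁2) (hb₂0n : 0 ≤ b₂0) (hb₂1n : 0 ≤ b₂1) (hb₂2n : 0 ≤ b₂2) (hc0n : 0 ≤ c0) (hc1n : 0 ≤ c1) (hc2n : 0 ≤ c2) (hd0n : 0 ≤ d0) (hd1n : 0 ≤ d1) (hd2n : 0 ≤ d2)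
    (hta0 : t0 ≤ p * (1 - (1 - r₁) * (1 - r₂)) - π * (p * max r₁ r₂ * nn))
    (hta1 : t0 ≤ p - π * ((1 + p * max r₁ r₂ * (nn - 1))))
    (hta2 : t0 ≤ 1 - π * (nn))
    (htb₁0 : t1 ≤ (1 - (1 - p) * (1 - r₁)) - π * ((1 - (1 - p) * (1 - r₁)) * r₂ * nn))
    (htb₁1 : t1 ≤ 1 - π * ((1 + (1 - (1 - p) * (1 - r₁)) * r₂ * (nn - 1))))
    (htb₁2 : t1 ≤ 1 - π * (nn))
    (htb₂0 : t2 ≤ (1 - (1 - p) * (1 - r₂)) - π * ((1 - (1 - p) * (1 - r₂)) * r₁ * nn))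
    (htb₂1 : t2 ≤ 1 - π * ((1 + (1 - (1 - p) * (1 - r₂)) * r₁ * (nn - 1))))
    (htb₂2 : t2 ≤ 1 - π * (nn))
    (htc0 : t3 ≤ p * (1 - (1 - r₁) * (1 - r₂)) - π * (p * (1 - (1 - r₁) * (1 - r₂)) * nn))
    (htc1 : t3 ≤ p - π * ((1 + p * (1 - (1 - r₁) * (1 - r₂)) * (nn - 1))))
    (htc2 : t3 ≤ 1 - π * (nn))
    (htd0 : t4 ≤ 1 - π * (0 * nn))
    (htd1 : t4 ≤ 1 - π * ((1 + 0 * (nn - 1))))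
    (htd2 : t4 ≤ 1 - π * (nn)) :
    t0 * (a0 + a1 + a2) + t1 * (b₁0 + b₁1 + b₁2) + t2 * (b₂0 + b₂1 + b₂2) + t3 * (c0 + c1 + c2) + t4 * (d0 + d1 + d2) ≤
      (p * (1 - (1 - r₁) * (1 - r₂)) * a0 + p * a1 + 1 * a2 + (1 - (1 - p) * (1 - r₁)) * b₁0 + 1 * b₁1 + 1 * b₁2 + (1 - (1 - p) * (1 - r₂)) * b₂0 + 1 * b₂1 + 1 * b₂2 + p * (1 - (1 - r₁) * (1 - r₂)) * c0 + p * c1 + 1 * c2 + 1 * d0 + 1 * d1 + 1 * d2) -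
        π * (p * max r₁ r₂ * nn * a0 + (1 + p * max r₁ r₂ * (nn - 1)) * a1 + nn * a2 + (1 - (1 - p) * (1 - r₁)) * r₂ * nn * b₁0 + (1 + (1 - (1 - p) * (1 - r₁)) * r₂ * (nn - 1)) * b₁1 + nn * b₁2 + (1 - (1 - p) * (1 - r₂)) * r₁ * nn * b₂0 + (1 + (1 - (1 - p) * (1 - r₂)) * r₁ * (nn - 1)) * b₂1 + nn * b₂2 + p * (1 - (1 - r₁) * (1 - r₂)) * nn * c0 + (1 + p * (1 - (1 - r₁) * (1 - r₂)) * (nn - 1)) * c1 + nn * c2 + 0 * nn * d0 + (1 + 0 * (nn - 1)) * d1 + nn * d2) := by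
  have ma0 := mul_le_mul_of_nonneg_right hta0 ha0n
  have ma1 := mul_le_mul_of_nonneg_right hta1 ha1n
  have ma2 := mul_le_mul_of_nonneg_right hta2 ha2n
  have mb₁0 := mul_le_mul_of_nonneg_right htb₁0 hb₁0n
  have mb₁1 := mul_le_mul_of_nonneg_right htb₁1 hb₁1n
  have mb₁2 := mul_le_mul_of_nonneg_right htb₁2 hb₁2n
  have mb₂0 := mul_le_mul_of_nonneg_right htb₂0 hb₂0n
  have mb₂1 := mul_le_mul_of_nonneg_right htb₂1 hb₂1n
  have mb₂2 := mul_le_mul_of_nonneg_right htb₂2 hb₂2n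
  have mc0 := mul_le_mul_of_nonneg_right htc0 hc0n
  have mc1 := mul_le_mul_of_nonneg_right htc1 hc1n
  have mc2 := mul_le_mul_of_nonneg_right htc2 hc2n
  have md0 := mul_le_mul_of_nonneg_right htd0 hd0n
  have md1 := mul_le_mul_of_nonneg_right htd1 hd1n
  have md2 := mul_le_mul_of_nonneg_right htd2 hd2n
  linarith [ma0, ma1, ma2, mb₁0, mb₁1, mb₁2, mb₂0, mb₂1, mb₂2, mc0, mc1, mc2, md0, md1, md2]

end Gate3

end Quant

end Summit.CriticalPhenomena.PercolationContinuityZ3.Theorems
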